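import Literature.IUT.HodgeTheaters.ThetaGeometryClaimsNonVacuity
import Literature.IUT.HodgeTheaters.PiAvatarBinding
import Literature.IUT.HodgeTheaters.InitialThetaDataArith
import HarnessLib

/-!
# The (β)-input chain of the D13 instance programme FIRES at an initial Θ-datum: consumers of the NV-L5 witness
# «ThetaGeometry.pe.ArrowCoveringClaims (JOINT)», the Galois case, and the kernel certificate of the witness gap
# (proof-only; abc-iut-L5-lead RULINGS #27 / #36 (1))

S. Mochizuki, *Inter-universal Teichmüller theory I*, RIMS manuscript (May 2020; = PRIMS **57** (2021)), §1 pp. 37–38,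
Def. 3.1 pp. 61–63, Example 6.3 (i)(ii) p. 161 ([IUTchI] Ex 6.3 (ii) p.161) [claim: Mochizuki2012, status: disputed]
(D-0012 claim key, series status DISPUTED — instantiations at a DEGENERATE π₁-side MODEL; nothing of the series is
asserted and no side is taken on [IUTchIII] Cor. 3.12).

* `not_arrowCoveringClaims_pedOf` / `not_arrowCoveringClaims_geometryOf` — the WITNESS GAP, kernel-certified: at
  abc-iut-S2's model of record `ThetaGeometryModel.geometryOf` (the tree's only other `ThetaGeometry` inhabitant family)
  the printed §1 claims are FALSE (`Δ_X̲ = 1`, so `[Δ_X̲ : jKer] = l` reads `1 = l`);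
* `exists_thetaGeometry_arrowCoveringClaims_galois` — the joint witness over `(F̄ ≃ₐ[F] F̄, G_K)` for a Galois extension;
* **`exists_initialThetaData_negCompat`** — for every arithmetic input of abc-iut-L5-t7's constructor
  `InitialThetaData.ofArith` (the GENUINE number-field side of Def 3.1 (a)(b)(c)) there is an initial Θ-datum `D`
  (`geom :=` the claims model) with `D.geom.pe.ArrowCoveringClaims` TRUE, at which abc-iut-L5-t4's (β)-square
  `exists_negCompat_phiEllAt` (p423760; via `exists_negCompat_good` p422024, `exists_localInvolution` p421621) is
  INSTANTIATED at every `G_v̲` — the hypothesis `hA` is discharged, not assumed.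
Honest label: genuine NF side, DEGENERATE π₁ side; instantiated ≠ endorsed.  Proof-only (0 defs).
-/

noncomputable section

namespace Literature.IUT.HodgeTheaters

namespace ThetaGeometryClaimsModel

open Literature.AnabelianGeometry.AbsoluteAnabelian Topology CategoryTheory

universe u

/-! ## The witness gap at the model of record (kernel certificate of the WHY) -/

section Gap

variable (G : Type u) [Group G] [TopologicalSpace G] [IsTopologicalGroup G] [CompactSpace G]
  [TotallyDisconnectedSpace G] (l : ℕ) [NeZero l]

/-- At abc-iut-S2's model `pedOf` the geometric part of `Π_{X̲}` is TRIVIAL: every cusp has decomposition group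
`G × {0} = Π_{X̲}`, so `Δ_X̲ = (G × {0}) ∩ ({1} × (ℤ/2 × ℤ/l)) = 1`. ([IUTchI] §1 p.37) [claim: Mochizuki2012, status: disputed] -/
theorem deltaXbar_pedOf_eq_bot (h5 : 5 ≤ l) (h6 : l.Coprime 6) :
    (ThetaGeometryModel.pedOf G l h5 h6).DeltaXbar = ⊥ := by
  rw [PuncturedEllipticData.DeltaXbar, ThetaGeometryModel.pedOf_PiXbar, eq_bot_iff]
  rintro ⟨g, d⟩ ⟨h1, h2⟩
  have hd : d ∈ (⊥ : Subgroup (ThetaGeometryModel.Fac l)) := h1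
  have hg : g = 1 := (FundamentalExtension.mem_geom _).mp h2
  rw [Subgroup.mem_bot] at hd ⊢
  rw [hg, hd]
  rfl

/-- **The printed §1 claims are FALSE at abc-iut-S2's model `pedOf`** (`ArrowCoveringClaims.jKer_relindex` asks
`[Δ_X̲ : jKer] = l`, but `Δ_X̲ = 1` there: `1 = l` contradicts `l ≥ 5`). The witness gap this module's siblings close.
([IUTchI] §1 p.38) [claim: Mochizuki2012, status: disputed] -/
theorem not_arrowCoveringClaims_pedOf (h5 : 5 ≤ l) (h6 : l.Coprime 6) :
    ¬ (ThetaGeometryModel.pedOf G l h5 h6).ArrowCoveringClaims := by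
  intro h
  have h1 := h.jKer_relindex
  rw [deltaXbar_pedOf_eq_bot, Subgroup.relIndex_bot_right] at h1
  have hl : (ThetaGeometryModel.pedOf G l h5 h6).l = l := rfl
  omega

variable {GF : Type u} [Group GF] [TopologicalSpace GF] [IsTopologicalGroup GF] [CompactSpace GF]
  [TotallyDisconnectedSpace GF] (GK : Subgroup GF)

/-- … hence at the model of record `geometryOf` (whose `pe` is `pedOf`) the hypothesis `hA` of the (β)-input chain is
false — before this module's siblings, NO `ThetaGeometry` in the tree had `pe.ArrowCoveringClaims`.
([IUTchI] §1 p.38) [claim: Mochizuki2012, status: disputed] -/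
theorem not_arrowCoveringClaims_geometryOf (hGK : IsClosed (GK : Set GF)) (h5 : 5 ≤ l) (h6 : l.Coprime 6) :
    ¬ (ThetaGeometryModel.geometryOf GK l hGK h5 h6).pe.ArrowCoveringClaims := by
  haveI : CompactSpace GK := isCompact_iff_compactSpace.mp hGK.isCompact
  exact not_arrowCoveringClaims_pedOf GK l h5 h6

end Gap

/-! ## The Galois case `G_F = Gal(F̄/F) ⊇ G_K = Gal(F̄/K)` -/

section Galois

variable (F K Fbar : Type*) [Field F] [Field K] [Field Fbar] [Algebra F K] [Algebra F Fbar] [Algebra K Fbar]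
  [IsScalarTower F K Fbar]

/-- **The joint witness in the Galois case**: for a Galois extension `F̄/F`, any intermediate `K` and `l ≥ 5` prime to
`6`, there is `T : ThetaGeometry (F̄ ≃ₐ[F] F̄) G_K l` with `T.pe.ArrowCoveringClaims`. ([IUTchI] Def 3.1 p.61) [claim: Mochizuki2012, status: disputed] -/
theorem exists_thetaGeometry_arrowCoveringClaims_galois [IsGalois F Fbar] {l : ℕ} (h5 : 5 ≤ l)
    (h6 : l.Coprime 6) :
    ∃ T : ThetaGeometry (Fbar ≃ₐ[F] Fbar) (galoisSubgroupOf F K Fbar) l, T.pe.ArrowCoveringClaims :=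
  haveI : NeZero l := ⟨by omega⟩
  exists_thetaGeometry_arrowCoveringClaims (galoisSubgroupOf F K Fbar) l
    (ThetaGeometryModel.isClosed_galoisSubgroupOf F K Fbar) h5 h6

end Galois

/-! ## The (β)-input chain fires at an initial Θ-datum -/

section Consumers

open NumberField

variable {F : Type u} [Field F] [NumberField F] (E : WeierstrassCurve F) [E.IsElliptic] (l : ℕ)

/-- A prime `l ≥ 5` is prime to `6`. [folklore] -/
private theorem coprime_six_of_prime (hp : l.Prime) (h5 : 5 ≤ l) : l.Coprime 6 := by
  refine (Nat.Prime.coprime_iff_not_dvd hp).mpr fun h => ?_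
  have hle := Nat.le_of_dvd (by norm_num) h
  interval_cases l
  · omega
  · exact absurd hp (by decide)

/-- **The (β)-input chain of abc-iut-L5-t4 FIRES.** For every arithmetic input `A` of [IUTchI] Def 3.1 (a)(b)(c)
(abc-iut-L5-t7's `ArithInput`: the GENUINE number-field side) and bad-place predicates with their two printed clauses,
there is an initial Θ-datum `D` over `(F, K := F(E[l]), F̄)` — abc-iut-L5-t7's `InitialThetaData.ofArith` with
`geom :=` the claims model — whose §1 datum SATISFIES the printed claims (`hA` discharged) and at which, for every
subgroup `G_v̲ ≤ G_F`, the `[−1]`-compatibility square of Example 6.3 (ii) on the bound objects holds: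
`a ≫ φ^{Θell}_{•,v̲} = φ^{Θell}_{•,v̲} ≫ b` with `a`, `b` non-trivial involutions (`exists_negCompat_phiEllAt`, p423760).
DEGENERATE π₁ side; instantiated ≠ endorsed. ([IUTchI] Ex 6.3 (ii) p.161) [claim: Mochizuki2012, status: disputed] -/
theorem exists_initialThetaData_negCompat (A : ArithInput E l) [NeZero l]
    (Pb : BadPlacePredicates (TorsionField E l))
    (hbad_type : ∀ w : Val (TorsionField E l),
      toVMod F (TorsionField E l) E w ∈ Val.non '' A.VbadMod → Pb.IsTypeOneZModLPM w)
    (hbad_cusp : ∀ w : Val (TorsionField E l),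
      toVMod F (TorsionField E l) E w ∈ Val.non '' A.VbadMod → Pb.IsCanonicalGeneratorCusp w) :
    ∃ D : InitialThetaData F (TorsionField E l) (AlgebraicClosure F) E l Pb,
      D.VbadMod = A.VbadMod ∧ D.geom.pe.ArrowCoveringClaims ∧
      ∀ Gv : Subgroup (AlgebraicClosure F ≃ₐ[F] AlgebraicClosure F),
        ∃ (a : D.locModelObj Gv ≅ D.locModelObj Gv) (b : D.gModelObj ≅ D.gModelObj),
          a ≠ Iso.refl _ ∧ a ≪≫ a = Iso.refl _ ∧ b ≠ Iso.refl _ ∧ b ≪≫ b = Iso.refl _ ∧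
            a.hom ≫ D.phiEllAt Gv = D.phiEllAt Gv ≫ b.hom := by
  haveI : IsGalois F (AlgebraicClosure F) := {}
  have h6 : l.Coprime 6 := coprime_six_of_prime l A.l_prime A.five_le_l
  have hGK := ThetaGeometryModel.isClosed_galoisSubgroupOf F (TorsionField E l) (AlgebraicClosure F)
  refine ⟨InitialThetaData.ofArith E l A Pb
    (geometryClaimsOf (galoisSubgroupOf F (TorsionField E l) (AlgebraicClosure F)) l hGK A.five_le_l h6)
    hbad_type hbad_cusp, rfl, ?_, fun Gv => ?_⟩
  · exact arrowCoveringClaims_geometryClaimsOf _ l hGK A.five_le_l h6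
  · exact InitialThetaData.exists_negCompat_phiEllAt _
      (arrowCoveringClaims_geometryClaimsOf _ l hGK A.five_le_l h6) Gv

end Consumers

end ThetaGeometryClaimsModel

end Literature.IUT.HodgeTheaters

end
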